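import Summits.Ventures.LatticeQCDFlow.Scaling.BooleanStarAveragedDrift

/-!
HONEST FRAMING: exact (Metropolis-corrected) sampling algorithms for lattice gauge theory; figures
of merit are autocorrelation/cost numbers at stated couplings and volumes; no continuum-physics
claim.

# BooleanStarTwoStepContraction — THE TWO-STEP CONTRACTION OF THE DISAGREEMENT POTENTIAL OF THE BOOLEAN STAR UNDER HUB
# DOMINATION `p·μ_k ≤ μ_0`: `Q²Φ ≤ (1 − δ)Φ`, `δ = min{(1−t)w_0(1−θ)·p·ct/m, ((1−t)w_0θ − (1−θ)t)/(K+θ)}`, AND `QΦ ≤ Φ` —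
# NO ACCEPTANCE FLOOR, NO VOLUME, NO REGIME (lean-2 GEN-30, ours)

Venture-side (OURS).  Cell `lqcd-flow` (pub-lqcd), unit `pub-lqcd-lean-2-g30`, 2026-08-28.  Chapter P (OPEN-MATH-chapterM item 1 on
the two-point family), file 11b.  `Scaling/BooleanStarAveragedDrift` gives the drift of `Φ` with the exact entry gain `G` and the averaged
acceptance `≥ p` after a common redraw; here the redraw branch of the coupled step is isolated (`boolSync_sum_gain_ge`: every branch of `Q`
is a non-negative weight times `G ≥ 0`, the redraw branch alone contributes `(1−t)w_0·Σ_v μ_0(v)G(x^{0↦v},y^{0↦v})`, and the redrawn pair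
has agreeing hubs and the same cold disagreements), which yields the two-step contraction.

## What is proved

* §10 **`boolSync_sum_gain_ge`** — if the hubs agree, `Σ_b Q(a,b)G(b) ≥ (1−t)w_0·(1−θ)(t/m)·p·Σ_r 𝟙{x_{κ_r+1} ≠ y_{κ_r+1}}`;
  `boolSync_step_potential_le_one` (`QΦ ≤ Φ` under `(1−θ)t ≤ (1−t)w_0θ`); **`boolSync_twoStep_potential_le`** — for every pair `a`,
  **`Σ_b Q(a,b)·Σ_{b'} Q(b,b')Φ(b') ≤ (1 − δ)·Φ(a)`, `δ = min{(1−t)w_0·(1−θ)·p·c·t/m, ((1−t)w_0·θ − (1−θ)t)/(K+θ)}`** (hubs agree: the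
  second step's gain, averaged over the first step's redraw, is `≥ (1−t)w_0(1−θ)(t/m)·p·c` per cold disagreement and
  `Φ = #{cold disagreements}`; hubs differ: the first step already gains `(1−t)w_0θ − (1−θ)t ≥ δ(θ+K) ≥ δΦ`).

NOT CLAIMED here: the law (`d(n) ≤ ((θ+K)/θ)(1−δ)^{⌊n/2⌋}`, file 12).  Literature grade (cell rule): OWN; nothing cited; no new bib keys.
-/

noncomputable section

open Finset Function
open Literature.Probability.MarkovChains

namespace Summit.Ventures.LatticeQCDFlow.Scaling

variable {K m : ℕ} {μ : Fin (K + 1) → Bool → ℝ} {M : Fin (K + 1) → Bool → Bool → ℝ} {w : Fin (K + 1) → ℝ} {t : ℝ}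

section TwoStep
variable (κ : Fin m → Fin K)

/-! ## §10 The two-step contraction -/

/-- **The redraw branch of the coupled step carries the gain:** if the hubs agree, then under hub domination
**`Σ_b Q(a,b)G(b) ≥ (1−t)w_0·(1−θ)·(t/m)·p·Σ_r 𝟙{x_{κ_r+1} ≠ y_{κ_r+1}}`** — every branch of `Q` is a non-negative weight times
`G ≥ 0`; the redraw branch alone contributes `(1−t)w_0·Σ_v μ_0(v)·G(x^{0↦v}, y^{0↦v})`, the redrawn pair has agreeing hubs and the
same cold disagreements, and its entry gains average to `≥ p` per listed disagreement (`sum_redraw_min_accept_ge`). [ours] -/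
theorem boolSync_sum_gain_ge (hm : 1 ≤ m) (ht0 : 0 ≤ t) (ht1 : t ≤ 1) (hw0 : ∀ k, 0 ≤ w k)
    (hμ : ∀ k x, 0 < μ k x) (hμ1 : ∀ k, ∑ u, μ k u = 1) (hM : ∀ k, IsRowStochastic (M k)) (hM0 : ∀ u v, M 0 u v = μ 0 v)
    {θ : ℝ} (hθ1 : θ ≤ 1) (hreg : (1 - θ) * t ≤ (1 - t) * w 0 * θ)
    {α : Fin m → (Fin (K + 1) → Bool) → ℝ}
    (hα : ∀ r z, α r z = min 1 (tensorFun μ (edgeFlowSwap (Equiv.refl Bool) 0 (κ r).succ z) / tensorFun μ z))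
    {p : ℝ} (hp : ∀ (j : Fin K) (s : Bool), p * μ j.succ s ≤ μ 0 s)
    {G : (Fin (K + 1) → Bool) × (Fin (K + 1) → Bool) → ℝ}
    (hG : ∀ a, G a = if a.1 0 = a.2 0
      then (1 - θ) * (t / m) * ∑ r : Fin m, min (α r a.1) (α r a.2) * (if a.1 (κ r).succ = a.2 (κ r).succ then (0 : ℝ) else 1)
      else (1 - t) * w 0 * θ - (1 - θ) * t)
    {Q : (Fin (K + 1) → Bool) × (Fin (K + 1) → Bool) → (Fin (K + 1) → Bool) × (Fin (K + 1) → Bool) → ℝ}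
    (hQ : ∀ a b, Q a b =
      ∑ r : Fin m, t / m *
        (min (α r a.1) (α r a.2) * (if b.1 = edgeFlowSwap (Equiv.refl Bool) 0 (κ r).succ a.1
              ∧ b.2 = edgeFlowSwap (Equiv.refl Bool) 0 (κ r).succ a.2 then (1 : ℝ) else 0)
          + (α r a.1 - min (α r a.1) (α r a.2)) * (if b.1 = edgeFlowSwap (Equiv.refl Bool) 0 (κ r).succ a.1 ∧ b.2 = a.2
              then (1 : ℝ) else 0)
          + (α r a.2 - min (α r a.1) (α r a.2)) * (if b.1 = a.1 ∧ b.2 = edgeFlowSwap (Equiv.refl Bool) 0 (κ r).succ a.2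
              then (1 : ℝ) else 0)
          + (1 - α r a.1 - α r a.2 + min (α r a.1) (α r a.2)) * (if b.1 = a.1 ∧ b.2 = a.2 then (1 : ℝ) else 0))
      + (1 - t) * ∑ k : Fin (K + 1), w k *
        (if a.1 k = a.2 k ∨ k = 0 then
            ∑ v : Bool, M k (a.1 k) v * (if b.1 = update a.1 k v ∧ b.2 = update a.2 k v then (1 : ℝ) else 0)
          else coordKernel M k a.1 b.1 * coordKernel M k a.2 b.2))
    (x y : Fin (K + 1) → Bool) :
    (1 - t) * w 0 * ((1 - θ) * (t / m) * p * ∑ r : Fin m, (if x (κ r).succ = y (κ r).succ then (0 : ℝ) else 1))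
      ≤ ∑ b, Q (x, y) b * G b := by
  have hmpos : (0 : ℝ) < m := Nat.cast_pos.mpr (by omega)
  have hG0 := boolSync_gain_nonneg κ hμ ht0 hθ1 hreg hα hG
  have hacc := accept_mem κ (fun _ : Fin m => Equiv.refl Bool) hμ hα
  set Sw : Fin m → ℝ := fun r =>
      min (α r x) (α r y) * G (edgeFlowSwap (Equiv.refl Bool) 0 (κ r).succ x, edgeFlowSwap (Equiv.refl Bool) 0 (κ r).succ y)
        + (α r x - min (α r x) (α r y)) * G (edgeFlowSwap (Equiv.refl Bool) 0 (κ r).succ x, y)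
        + (α r y - min (α r x) (α r y)) * G (x, edgeFlowSwap (Equiv.refl Bool) 0 (κ r).succ y)
        + (1 - α r x - α r y + min (α r x) (α r y)) * G (x, y) with hSw
  set Up : Fin (K + 1) → ℝ := fun k => ∑ b : (Fin (K + 1) → Bool) × (Fin (K + 1) → Bool),
      (if x k = y k ∨ k = 0 then
          ∑ v : Bool, M k (x k) v * (if b.1 = update x k v ∧ b.2 = update y k v then (1 : ℝ) else 0)
        else coordKernel M k x b.1 * coordKernel M k y b.2) * G b with hUp
  have hexp : ∑ b, Q (x, y) b * G b = ∑ r : Fin m, t / m * Sw r + ∑ k : Fin (K + 1), ((1 - t) * w k) * Up k := by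
    have hsplit : ∑ b, Q (x, y) b * G b
        = ∑ b : (Fin (K + 1) → Bool) × (Fin (K + 1) → Bool), (∑ r : Fin m, t / m *
            (min (α r x) (α r y) * (if b.1 = edgeFlowSwap (Equiv.refl Bool) 0 (κ r).succ x
                  ∧ b.2 = edgeFlowSwap (Equiv.refl Bool) 0 (κ r).succ y then (1 : ℝ) else 0)
              + (α r x - min (α r x) (α r y)) * (if b.1 = edgeFlowSwap (Equiv.refl Bool) 0 (κ r).succ x ∧ b.2 = y
                  then (1 : ℝ) else 0)
              + (α r y - min (α r x) (α r y)) * (if b.1 = x ∧ b.2 = edgeFlowSwap (Equiv.refl Bool) 0 (κ r).succ y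
                  then (1 : ℝ) else 0)
              + (1 - α r x - α r y + min (α r x) (α r y)) * (if b.1 = x ∧ b.2 = y then (1 : ℝ) else 0))) * G b
          + ∑ b : (Fin (K + 1) → Bool) × (Fin (K + 1) → Bool), (∑ k : Fin (K + 1), ((1 - t) * w k) *
            (if x k = y k ∨ k = 0 then
                ∑ v : Bool, M k (x k) v * (if b.1 = update x k v ∧ b.2 = update y k v then (1 : ℝ) else 0)
              else coordKernel M k x b.1 * coordKernel M k y b.2)) * G b := by
      rw [← Finset.sum_add_distrib]
      refine sum_congr rfl fun b _ => ?_
      rw [hQ, ← add_mul]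
      congr 2
      rw [Finset.mul_sum]
      exact sum_congr rfl fun k _ => by ring
    rw [hsplit, sum_mixture_mul, sum_mixture_mul]
    congr 1
    exact sum_congr rfl fun r _ => by rw [syncSwap_sum_potential]
  rw [hexp]
  -- every entry branch is non-negative
  have hSw0 : ∀ r, 0 ≤ Sw r := fun r => by
    obtain ⟨h1, h2, h3, h4⟩ := syncSwap_weights_nonneg (hacc r x).1 (hacc r x).2 (hacc r y).1 (hacc r y).2
    exact add_nonneg (add_nonneg (add_nonneg (mul_nonneg h1 (hG0 _)) (mul_nonneg h2 (hG0 _))) (mul_nonneg h3 (hG0 _)))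
      (mul_nonneg h4 (hG0 _))
  -- every update branch is non-negative
  have hUp0 : ∀ k, 0 ≤ Up k := fun k => by
    refine sum_nonneg fun b _ => mul_nonneg ?_ (hG0 b)
    split_ifs
    · exact sum_nonneg fun v _ => mul_nonneg ((hM k).1 _ _) (by split_ifs <;> norm_num)
    · exact mul_nonneg (coordKernel_nonneg M (fun j u v => (hM j).1 u v) k x b.1)
        (coordKernel_nonneg M (fun j u v => (hM j).1 u v) k y b.2)
  -- the redraw branch
  have hUp0eq : Up 0 = ∑ v : Bool, μ 0 v * G (update x 0 v, update y 0 v) := by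
    rw [hUp]
    simp only [or_true, if_true]
    rw [sum_mixture_mul]
    simp_rw [sum_ite_and_mul, hM0]
  have hred : (1 - θ) * (t / m) * p * ∑ r : Fin m, (if x (κ r).succ = y (κ r).succ then (0 : ℝ) else 1)
      ≤ (1 - θ) * (t / m) * ∑ r : Fin m, (∑ u : Bool, μ 0 u * min (α r (update x 0 u)) (α r (update y 0 u)))
        * (if x (κ r).succ = y (κ r).succ then (0 : ℝ) else 1) := by
    rw [mul_assoc ((1 - θ) * (t / m)) p, Finset.mul_sum]
    exact mul_le_mul_of_nonneg_left (sum_le_sum fun r _ => mul_le_mul_of_nonneg_right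
      (sum_redraw_min_accept_ge κ hμ hμ1 hα hp r x y) (by split_ifs <;> norm_num))
      (mul_nonneg (sub_nonneg.mpr hθ1) (div_nonneg ht0 hmpos.le))
  have hGv : ∑ v : Bool, μ 0 v * G (update x 0 v, update y 0 v)
      = (1 - θ) * (t / m) * ∑ r : Fin m, (∑ u : Bool, μ 0 u * min (α r (update x 0 u)) (α r (update y 0 u)))
        * (if x (κ r).succ = y (κ r).succ then (0 : ℝ) else 1) := by
    have hv : ∀ v : Bool, G (update x 0 v, update y 0 v) = (1 - θ) * (t / m)
        * ∑ r : Fin m, min (α r (update x 0 v)) (α r (update y 0 v)) * (if x (κ r).succ = y (κ r).succ then (0 : ℝ) else 1) := by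
      intro v
      have hc : (update x 0 v, update y 0 v).1 0 = (update x 0 v, update y 0 v).2 0 := by
        show update x 0 v 0 = update y 0 v 0
        rw [update_self, update_self]
      rw [hG, if_pos hc]
      dsimp only
      congr 1
    calc ∑ v : Bool, μ 0 v * G (update x 0 v, update y 0 v)
        = ∑ v : Bool, (1 - θ) * (t / m) * ∑ r : Fin m, μ 0 v * (min (α r (update x 0 v)) (α r (update y 0 v))
            * (if x (κ r).succ = y (κ r).succ then (0 : ℝ) else 1)) := sum_congr rfl fun v _ => by
          rw [hv v, Finset.mul_sum, Finset.mul_sum, Finset.mul_sum]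
          exact sum_congr rfl fun r _ => by ring
      _ = (1 - θ) * (t / m) * ∑ v : Bool, ∑ r : Fin m, μ 0 v * (min (α r (update x 0 v)) (α r (update y 0 v))
            * (if x (κ r).succ = y (κ r).succ then (0 : ℝ) else 1)) := by rw [← Finset.mul_sum]
      _ = (1 - θ) * (t / m) * ∑ r : Fin m, (∑ u : Bool, μ 0 u * min (α r (update x 0 u)) (α r (update y 0 u)))
            * (if x (κ r).succ = y (κ r).succ then (0 : ℝ) else 1) := by
          rw [Finset.sum_comm]
          congr 1
          refine sum_congr rfl fun r _ => ?_
          rw [Finset.sum_mul]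
          exact sum_congr rfl fun u _ => by ring
  calc (1 - t) * w 0 * ((1 - θ) * (t / m) * p * ∑ r : Fin m, (if x (κ r).succ = y (κ r).succ then (0 : ℝ) else 1))
      ≤ (1 - t) * w 0 * Up 0 := by
        rw [hUp0eq, hGv]
        exact mul_le_mul_of_nonneg_left hred (mul_nonneg (by linarith) (hw0 0))
    _ = ∑ k ∈ ({0} : Finset (Fin (K + 1))), ((1 - t) * w k) * Up k := by rw [sum_singleton, mul_assoc]
    _ ≤ ∑ k : Fin (K + 1), ((1 - t) * w k) * Up k :=
        sum_le_sum_of_subset_of_nonneg (subset_univ _) fun k _ _ => mul_nonneg (mul_nonneg (by linarith) (hw0 k)) (hUp0 k)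
    _ ≤ ∑ r : Fin m, t / m * Sw r + ∑ k : Fin (K + 1), ((1 - t) * w k) * Up k :=
        le_add_of_nonneg_left (sum_nonneg fun r _ => mul_nonneg (by positivity) (hSw0 r))

/-- **THE ONE-STEP SUPERMARTINGALE (no floor):** `Σ_b Q(a,b)Φ(b) ≤ Φ(a)` under `(1−θ)t ≤ (1−t)w_0·θ`. [ours] -/
theorem boolSync_step_potential_le_one (hm : 1 ≤ m) (ht0 : 0 ≤ t) (ht1 : t ≤ 1) (hw0 : ∀ k, 0 ≤ w k) (hw1 : ∑ k, w k = 1)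
    (hμ : ∀ k x, 0 < μ k x) (hM : ∀ k, IsRowStochastic (M k)) {θ : ℝ} (hθ0 : 0 ≤ θ) (hθ1 : θ ≤ 1)
    (hreg : (1 - θ) * t ≤ (1 - t) * w 0 * θ)
    {α : Fin m → (Fin (K + 1) → Bool) → ℝ}
    (hα : ∀ r z, α r z = min 1 (tensorFun μ (edgeFlowSwap (Equiv.refl Bool) 0 (κ r).succ z) / tensorFun μ z))
    {Φ : (Fin (K + 1) → Bool) × (Fin (K + 1) → Bool) → ℝ}
    (hΦ : ∀ a, Φ a = ∑ k : Fin (K + 1), (if k = 0 then θ else 1) * (if a.1 k = a.2 k then (0 : ℝ) else 1))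
    {Q : (Fin (K + 1) → Bool) × (Fin (K + 1) → Bool) → (Fin (K + 1) → Bool) × (Fin (K + 1) → Bool) → ℝ}
    (hQ : ∀ a b, Q a b =
      ∑ r : Fin m, t / m *
        (min (α r a.1) (α r a.2) * (if b.1 = edgeFlowSwap (Equiv.refl Bool) 0 (κ r).succ a.1
              ∧ b.2 = edgeFlowSwap (Equiv.refl Bool) 0 (κ r).succ a.2 then (1 : ℝ) else 0)
          + (α r a.1 - min (α r a.1) (α r a.2)) * (if b.1 = edgeFlowSwap (Equiv.refl Bool) 0 (κ r).succ a.1 ∧ b.2 = a.2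
              then (1 : ℝ) else 0)
          + (α r a.2 - min (α r a.1) (α r a.2)) * (if b.1 = a.1 ∧ b.2 = edgeFlowSwap (Equiv.refl Bool) 0 (κ r).succ a.2
              then (1 : ℝ) else 0)
          + (1 - α r a.1 - α r a.2 + min (α r a.1) (α r a.2)) * (if b.1 = a.1 ∧ b.2 = a.2 then (1 : ℝ) else 0))
      + (1 - t) * ∑ k : Fin (K + 1), w k *
        (if a.1 k = a.2 k ∨ k = 0 then
            ∑ v : Bool, M k (a.1 k) v * (if b.1 = update a.1 k v ∧ b.2 = update a.2 k v then (1 : ℝ) else 0)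
          else coordKernel M k a.1 b.1 * coordKernel M k a.2 b.2))
    (a : (Fin (K + 1) → Bool) × (Fin (K + 1) → Bool)) : ∑ b, Q a b * Φ b ≤ Φ a := by
  set G : (Fin (K + 1) → Bool) × (Fin (K + 1) → Bool) → ℝ := fun a => if a.1 0 = a.2 0
      then (1 - θ) * (t / m) * ∑ r : Fin m, min (α r a.1) (α r a.2) * (if a.1 (κ r).succ = a.2 (κ r).succ then (0 : ℝ) else 1)
      else (1 - t) * w 0 * θ - (1 - θ) * t with hG
  have h := boolSync_step_potential_le_gain κ hm ht0 ht1 hw0 hw1 hμ hM hθ0 hθ1 hα hΦ (G := G) (fun _ => rfl) hQ a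
  linarith [boolSync_gain_nonneg κ hμ ht0 hθ1 hreg hα (G := G) (fun _ => rfl) a]

/-- **THE TWO-STEP CONTRACTION OF THE DISAGREEMENT POTENTIAL UNDER HUB DOMINATION.**  Boolean star (two-point replicas with
positive laws summing to one, identity entry maps on the hub list `κ` with multiplicities `≥ c`, exact hot redraws, row-stochastic
cold kernels, `m ≥ 1`, `0 ≤ t ≤ 1`, `w` a probability vector), hub domination `p·μ_k(s) ≤ μ_0(s)`, `0 < θ ≤ 1` with
`(1−θ)t ≤ (1−t)w_0·θ`, synchronous coupling `Q`: for every pair `a`,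
**`Σ_b Q(a,b)·Σ_{b'} Q(b,b')Φ(b') ≤ (1 − δ)·Φ(a)`, `δ = min{(1−t)w_0·(1−θ)·p·c·t/m, ((1−t)w_0·θ − (1−θ)t)/(K+θ)}`** — NO acceptance
floor.  (Hubs agree: the second step's gain, averaged over the first step's redraw, is `≥ (1−t)w_0(1−θ)(t/m)·p·c` per cold
disagreement and `Φ = #{cold disagreements}`; hubs differ: the first step already gains `(1−t)w_0θ − (1−θ)t ≥ δ(θ+K) ≥ δΦ`.) [ours] -/
theorem boolSync_twoStep_potential_le (hm : 1 ≤ m) (ht0 : 0 ≤ t) (ht1 : t ≤ 1) (hw0 : ∀ k, 0 ≤ w k) (hw1 : ∑ k, w k = 1)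
    (hμ : ∀ k x, 0 < μ k x) (hμ1 : ∀ k, ∑ u, μ k u = 1) (hM : ∀ k, IsRowStochastic (M k)) (hM0 : ∀ u v, M 0 u v = μ 0 v)
    {θ : ℝ} (hθ0 : 0 < θ) (hθ1 : θ ≤ 1) (hreg : (1 - θ) * t ≤ (1 - t) * w 0 * θ)
    {c : ℕ} (hc : ∀ p' : Fin K, c ≤ (univ.filter (fun r : Fin m => κ r = p')).card)
    {α : Fin m → (Fin (K + 1) → Bool) → ℝ}
    (hα : ∀ r z, α r z = min 1 (tensorFun μ (edgeFlowSwap (Equiv.refl Bool) 0 (κ r).succ z) / tensorFun μ z))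
    {p : ℝ} (hp0 : 0 ≤ p) (hp : ∀ (j : Fin K) (s : Bool), p * μ j.succ s ≤ μ 0 s)
    {Φ : (Fin (K + 1) → Bool) × (Fin (K + 1) → Bool) → ℝ}
    (hΦ : ∀ a, Φ a = ∑ k : Fin (K + 1), (if k = 0 then θ else 1) * (if a.1 k = a.2 k then (0 : ℝ) else 1))
    {Q : (Fin (K + 1) → Bool) × (Fin (K + 1) → Bool) → (Fin (K + 1) → Bool) × (Fin (K + 1) → Bool) → ℝ}
    (hQ : ∀ a b, Q a b =
      ∑ r : Fin m, t / m *
        (min (α r a.1) (α r a.2) * (if b.1 = edgeFlowSwap (Equiv.refl Bool) 0 (κ r).succ a.1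
              ∧ b.2 = edgeFlowSwap (Equiv.refl Bool) 0 (κ r).succ a.2 then (1 : ℝ) else 0)
          + (α r a.1 - min (α r a.1) (α r a.2)) * (if b.1 = edgeFlowSwap (Equiv.refl Bool) 0 (κ r).succ a.1 ∧ b.2 = a.2
              then (1 : ℝ) else 0)
          + (α r a.2 - min (α r a.1) (α r a.2)) * (if b.1 = a.1 ∧ b.2 = edgeFlowSwap (Equiv.refl Bool) 0 (κ r).succ a.2
              then (1 : ℝ) else 0)
          + (1 - α r a.1 - α r a.2 + min (α r a.1) (α r a.2)) * (if b.1 = a.1 ∧ b.2 = a.2 then (1 : ℝ) else 0))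
      + (1 - t) * ∑ k : Fin (K + 1), w k *
        (if a.1 k = a.2 k ∨ k = 0 then
            ∑ v : Bool, M k (a.1 k) v * (if b.1 = update a.1 k v ∧ b.2 = update a.2 k v then (1 : ℝ) else 0)
          else coordKernel M k a.1 b.1 * coordKernel M k a.2 b.2))
    (a : (Fin (K + 1) → Bool) × (Fin (K + 1) → Bool)) :
    ∑ b, Q a b * ∑ b', Q b b' * Φ b'
      ≤ (1 - min ((1 - t) * w 0 * (1 - θ) * p * c * t / m) (((1 - t) * w 0 * θ - (1 - θ) * t) / (K + θ))) * Φ a := by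
  obtain ⟨x, y⟩ := a
  have hmpos : (0 : ℝ) < m := Nat.cast_pos.mpr (by omega)
  set G : (Fin (K + 1) → Bool) × (Fin (K + 1) → Bool) → ℝ := fun a => if a.1 0 = a.2 0
      then (1 - θ) * (t / m) * ∑ r : Fin m, min (α r a.1) (α r a.2) * (if a.1 (κ r).succ = a.2 (κ r).succ then (0 : ℝ) else 1)
      else (1 - t) * w 0 * θ - (1 - θ) * t with hG
  have hgain := boolSync_step_potential_le_gain κ hm ht0 ht1 hw0 hw1 hμ hM hθ0.le hθ1 hα hΦ (G := G) (fun _ => rfl) hQ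
  have hG0 := boolSync_gain_nonneg κ hμ ht0 hθ1 hreg hα (G := G) (fun _ => rfl)
  have hP : IsRowStochastic (fun y z : Fin (K + 1) → Bool =>
      t * ptGraphSwap μ (fun r : Fin m => (((0 : Fin (K + 1)), (κ r).succ) : Fin (K + 1) × Fin (K + 1)))
            (fun _ : Fin m => Equiv.refl Bool) y z + (1 - t) * prodKernel w M y z) :=
    weightedScheme_isRowStochastic (ptGraphSwap_isRowStochastic hμ) hM hw0 hw1 ht0 ht1
  have hQs : IsRowStochastic Q := (boolSync_isMarkovianCoupling κ hm ht0 ht1 hw0 hμ hM hM0 hα hQ).isRowStochastic hP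
  have hΦ0 := potential_nonneg hθ0.le hΦ (x, y)
  have hΦK := potential_le hθ0.le hΦ x y
  have hhub := potential_eq_hub_add_cold hΦ x y
  set δ := min ((1 - t) * w 0 * (1 - θ) * p * c * t / m) (((1 - t) * w 0 * θ - (1 - θ) * t) / (K + θ)) with hδ
  have hw00 : 0 ≤ (1 - t) * w 0 := mul_nonneg (by linarith) (hw0 0)
  have hδ0 : 0 ≤ δ := le_min (by have := sub_nonneg.mpr hθ1; positivity) (div_nonneg (by linarith) (by positivity))
  -- the second step loses at least the gain; the first step loses at least its own gain
  have hstep2 : ∑ b, Q (x, y) b * ∑ b', Q b b' * Φ b' ≤ ∑ b, Q (x, y) b * Φ b - ∑ b, Q (x, y) b * G b := by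
    rw [← Finset.sum_sub_distrib]
    exact sum_le_sum fun b _ => by
      have := mul_le_mul_of_nonneg_left (hgain b) (hQs.1 (x, y) b)
      rw [mul_sub] at this; linarith
  have hstep1 := hgain (x, y)
  by_cases h0 : x 0 = y 0
  · -- hubs agree: use the second step's averaged gain
    rw [if_pos h0, mul_zero, zero_add] at hhub
    have hred := boolSync_sum_gain_ge κ hm ht0 ht1 hw0 hμ hμ1 hM hM0 hθ1 hreg hα hp (G := G) (fun _ => rfl) hQ x y
    have hcnt := sum_entries_disagree_ge κ hc x y
    have hD : (1 - t) * w 0 * (1 - θ) * p * c * t / m * Φ (x, y)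
        ≤ (1 - t) * w 0 * ((1 - θ) * (t / m) * p * ∑ r : Fin m, (if x (κ r).succ = y (κ r).succ then (0 : ℝ) else 1)) := by
      have h := mul_le_mul_of_nonneg_left hcnt (show (0 : ℝ) ≤ (1 - t) * w 0 * (1 - θ) * p * (t / m) by
        have := sub_nonneg.mpr hθ1; positivity)
      calc (1 - t) * w 0 * (1 - θ) * p * c * t / m * Φ (x, y)
          = (1 - t) * w 0 * (1 - θ) * p * (t / m) * (c * ∑ j : Fin K, (if x j.succ = y j.succ then (0 : ℝ) else 1)) := by
            rw [← hhub]; ring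
        _ ≤ (1 - t) * w 0 * (1 - θ) * p * (t / m) * ∑ r : Fin m, (if x (κ r).succ = y (κ r).succ then (0 : ℝ) else 1) := h
        _ = (1 - t) * w 0 * ((1 - θ) * (t / m) * p * ∑ r : Fin m, (if x (κ r).succ = y (κ r).succ then (0 : ℝ) else 1)) := by
            ring
    have hmin : δ ≤ (1 - t) * w 0 * (1 - θ) * p * c * t / m := min_le_left _ _
    have hδΦ : δ * Φ (x, y) ≤ (1 - t) * w 0 * (1 - θ) * p * c * t / m * Φ (x, y) := mul_le_mul_of_nonneg_right hmin hΦ0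
    linarith [hstep2, hstep1, hG0 (x, y), hred, hD, hδΦ]
  · -- hubs differ: the first step's gain suffices
    have hG1 : G (x, y) = (1 - t) * w 0 * θ - (1 - θ) * t := by rw [hG]; exact if_neg h0
    have hQG : 0 ≤ ∑ b, Q (x, y) b * G b := sum_nonneg fun b _ => mul_nonneg (hQs.1 _ _) (hG0 b)
    have hmin : δ ≤ ((1 - t) * w 0 * θ - (1 - θ) * t) / (K + θ) := min_le_right _ _
    have hKθ : (0 : ℝ) < K + θ := by positivity
    have hδK : δ * Φ (x, y) ≤ (1 - t) * w 0 * θ - (1 - θ) * t := by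
      calc δ * Φ (x, y) ≤ δ * (θ + K) := mul_le_mul_of_nonneg_left hΦK hδ0
        _ ≤ ((1 - t) * w 0 * θ - (1 - θ) * t) / (K + θ) * (θ + K) := mul_le_mul_of_nonneg_right hmin (by positivity)
        _ = (1 - t) * w 0 * θ - (1 - θ) * t := by field_simp; ring
    linarith [hstep2, hstep1, hQG, hδK, hG1]

end TwoStep

end Summit.Ventures.LatticeQCDFlow.Scaling

end
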